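import Mathlib
import HarnessLib
import Summits.NavierStokesRegularity.NavierStokesRegularity.Theorems.PoloidalWindowDoorLrcModEntireAxisKinematics3
import Summits.NavierStokesRegularity.NavierStokesRegularity.Theorems.PoloidalWindowDoorLrcModEntireAxisKinematics7
import Summits.NavierStokesRegularity.NavierStokesRegularity.Theorems.PoloidalWindowDoorLrcModEntireAxisKinematics9

/-!
# Route `PoloidalWindowDoor`, item `LrcModEntire` (stmt-NavierStokesRegularity-20428) — AXIS KINEMATICS X: the LOCAL DICHOTOMY
# «moving centre ⇒ the radial profile has `P_rr · U_w U_{c′} = 0`» (assembly of III + VI + VII + VIII + IX at one height)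

Cell ns-regularity-ideate, seat ns-poloidal-K2-p3 gen 5 (LEAD of item 20428; file landed `--supports stmt-NavierStokesRegularity-20428` as a
helper).  Plan step VIII-a of AXIS-NOTE.  Data: `V ∈ C³(ℝ³)`, a `C³` centre curve `(c₀, c₁)`, an open `O` on which (R) `L V = 0`
(`V` rotation-invariant about the moving vertical axis) and (S) `L(∂₂²V) = 0` (`∂₂²V` rotation-invariant about the same axis), where
`L f(y) = (y₀ − c₀(y₂))∂₁f(y) − (y₁ − c₁(y₂))∂₀f(y)`.  At a point `y⋆ ∈ O` off the axis let `P` be the radial profile of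
`…AxisKinematics6.exists_radial_of_rotGerm_moving` (`V = P(ρ_c², z)` near `y⋆`).  Then on a neighbourhood `B` of `y⋆`, at the height
`z₀ = (y⋆)₂`:  **`P_rr(Ψ y) · U_w(y) · U_{c′(z₀)}(y) = 0`** for all `y ∈ B` with `y₂ = z₀`, where `w = J c′(z₀)` — i.e. (by
`…AxisKinematics4.eq_zero_of_mul_hdot_eq_zero`, per plane) EITHER `c′(z₀) = 0` OR `P_rr = 0` along the plane: the profile is a Hill-type
quadratic `kρ² + m` there (excluded in the class by `…AxisKinematics5`).

* `axis_dichotomy_local` — the statement above.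

WHAT THIS IS NOT: not a claim about Navier–Stokes regularity and not yet the class-level axis theorem (the per-plane `α = 0` step, the
integration `P_rr = 0 ⇒ quadratic`, the planar identity theorem and the kinematic derivation of (S) remain) — calculus assembly
(bears_on LADDER-NS N0 via item 20428).
-/

noncomputable section

-- the summit and its single sub-problem share the name (CONVENTIONS §1), as in every Theorems file
set_option linter.dupNamespace false

namespace Summit.NavierStokesRegularity.NavierStokesRegularity.Theorems.PoloidalWindowDoorLrcModEntireAxisKinematics10

open Set Function Filter Topology Metric
open scoped RealInnerProductSpace InnerProductSpace
open Literature.Analysis Literature.Analysis.FluidPDE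
open Summit.NavierStokesRegularity.NavierStokesRegularity.Theorems.PoloidalWindowDoorLrcModEntireAxisKinematics
open Summit.NavierStokesRegularity.NavierStokesRegularity.Theorems.PoloidalWindowDoorLrcModEntireAxisKinematics3
open Summit.NavierStokesRegularity.NavierStokesRegularity.Theorems.PoloidalWindowDoorLrcModEntireAxisKinematics6
open Summit.NavierStokesRegularity.NavierStokesRegularity.Theorems.PoloidalWindowDoorLrcModEntireAxisKinematics7
open Summit.NavierStokesRegularity.NavierStokesRegularity.Theorems.PoloidalWindowDoorLrcModEntireAxisKinematics8
open Summit.NavierStokesRegularity.NavierStokesRegularity.Theorems.PoloidalWindowDoorLrcModEntireAxisKinematics9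

/-- **THE LOCAL DICHOTOMY.**  See the module docstring: under (R) and (S) on an open `O`, for `y⋆ ∈ O` off the moving axis there are a
radial profile `P` (`Cᶟ` at `Ψ y⋆`, `V = P(ρ_c², z)` near `y⋆`) and a neighbourhood `B` of `y⋆` such that for every `y ∈ B` at the height
`z₀ = (y⋆)₂`: `P_rr(Ψ y) · [U_w(y) · U_{c′(z₀)}(y)] = 0`, `w = Jc′(z₀)`, `U_p(y) = (y₀ − c₀(z₀))p₀ + (y₁ − c₁(z₀))p₁`,
`P_rr = D(q ↦ DP(q)(1,0))(Ψ y)(1,0)`. -/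
theorem axis_dichotomy_local {V : EuclideanSpace ℝ (Fin 3) → ℝ} (hV : ContDiff ℝ 3 V) {c₀ c₁ : ℝ → ℝ}
    (hc₀ : ContDiff ℝ 3 c₀) (hc₁ : ContDiff ℝ 3 c₁) {O : Set (EuclideanSpace ℝ (Fin 3))} (hO : IsOpen O)
    (hR : ∀ y ∈ O, (y 0 - c₀ (y 2)) * fderiv ℝ V y (EuclideanSpace.single 1 1) -
      (y 1 - c₁ (y 2)) * fderiv ℝ V y (EuclideanSpace.single 0 1) = 0)
    (hS : ∀ y ∈ O, (y 0 - c₀ (y 2)) *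
          fderiv ℝ (fun y' => fderiv ℝ (fun y'' => fderiv ℝ V y'' (EuclideanSpace.single 2 1)) y' (EuclideanSpace.single 2 1)) y
            (EuclideanSpace.single 1 1) -
        (y 1 - c₁ (y 2)) *
          fderiv ℝ (fun y' => fderiv ℝ (fun y'' => fderiv ℝ V y'' (EuclideanSpace.single 2 1)) y' (EuclideanSpace.single 2 1)) y
            (EuclideanSpace.single 0 1) = 0)
    {ys : EuclideanSpace ℝ (Fin 3)} (hys : ys ∈ O) (hoff : ys 0 ≠ c₀ (ys 2) ∨ ys 1 ≠ c₁ (ys 2)) :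
    ∃ P : ℝ × ℝ → ℝ, ContDiffAt ℝ 3 P ((ys 0 - c₀ (ys 2)) ^ 2 + (ys 1 - c₁ (ys 2)) ^ 2, ys 2) ∧
      (∀ᶠ y in 𝓝 ys, V y = P ((y 0 - c₀ (y 2)) ^ 2 + (y 1 - c₁ (y 2)) ^ 2, y 2)) ∧
      ∀ᶠ y in 𝓝 ys, y 2 = ys 2 →
        fderiv ℝ (fun q => fderiv ℝ P q (1, 0)) ((y 0 - c₀ (y 2)) ^ 2 + (y 1 - c₁ (y 2)) ^ 2, y 2) (1, 0) *
          (((y 0 - c₀ (ys 2)) * (-deriv c₁ (ys 2)) + (y 1 - c₁ (ys 2)) * deriv c₀ (ys 2)) *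
            ((y 0 - c₀ (ys 2)) * deriv c₀ (ys 2) + (y 1 - c₁ (ys 2)) * deriv c₁ (ys 2))) = 0 := by
  -- regularity of the data
  have h3ne : (3 : WithTop ℕ∞) ≠ 0 := by norm_num
  have hc₀2 : ContDiff ℝ 2 c₀ := hc₀.of_le (by norm_num)
  have hc₁2 : ContDiff ℝ 2 c₁ := hc₁.of_le (by norm_num)
  have hc₀d : Differentiable ℝ c₀ := hc₀.differentiable (by norm_num)
  have hc₁d : Differentiable ℝ c₁ := hc₁.differentiable (by norm_num)
  have hc₀' : Differentiable ℝ (deriv c₀) := by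
    have := hc₀2.iterate_deriv' 1 1
    simpa using this.differentiable (by norm_num)
  have hc₁' : Differentiable ℝ (deriv c₁) := by
    have := hc₁2.iterate_deriv' 1 1
    simpa using this.differentiable (by norm_num)
  -- the radial profile near `ys` (…AxisKinematics6)
  have hrot : ∀ᶠ y in 𝓝 ys, (y 0 - c₀ (y 2)) * fderiv ℝ V y (EuclideanSpace.single 1 1) -
      (y 1 - c₁ (y 2)) * fderiv ℝ V y (EuclideanSpace.single 0 1) = 0 :=
    Filter.eventually_of_mem (hO.mem_nhds hys) fun y hy => hR y hy
  obtain ⟨P, hPc, hPeq⟩ := exists_radial_of_rotGerm_moving h3ne hV.contDiffAt hc₀ hc₁ hrot hoff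
  refine ⟨P, hPc, hPeq, ?_⟩
  -- continuity of `Ψ y = (g y, y₂)`
  have hΨc : Continuous (fun y : EuclideanSpace ℝ (Fin 3) => ((y 0 - c₀ (y 2)) ^ 2 + (y 1 - c₁ (y 2)) ^ 2, y 2)) := by
    have h0 : Continuous (fun y' : EuclideanSpace ℝ (Fin 3) => y' 0) :=
      (EuclideanSpace.proj (0 : Fin 3) : EuclideanSpace ℝ (Fin 3) →L[ℝ] ℝ).continuous
    have h1 : Continuous (fun y' : EuclideanSpace ℝ (Fin 3) => y' 1) :=
      (EuclideanSpace.proj (1 : Fin 3) : EuclideanSpace ℝ (Fin 3) →L[ℝ] ℝ).continuous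
    have h2 : Continuous (fun y' : EuclideanSpace ℝ (Fin 3) => y' 2) :=
      (EuclideanSpace.proj (2 : Fin 3) : EuclideanSpace ℝ (Fin 3) →L[ℝ] ℝ).continuous
    exact (((h0.sub (hc₀d.continuous.comp h2)).pow 2).add ((h1.sub (hc₁d.continuous.comp h2)).pow 2)).prodMk h2
  have hΨd : ∀ y : EuclideanSpace ℝ (Fin 3), DifferentiableAt ℝ (fun y : EuclideanSpace ℝ (Fin 3) => ((y 0 - c₀ (y 2)) ^ 2 + (y 1 - c₁ (y 2)) ^ 2, y 2)) y := fun y =>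
    ((hasFDerivAt_sqDistMoving (hc₀d _) (hc₁d _)).prodMk
      ((EuclideanSpace.proj (2 : Fin 3) : EuclideanSpace ℝ (Fin 3) →L[ℝ] ℝ).hasFDerivAt)).differentiableAt
  -- `P` is `C³` at `Ψ y` for `y` near `ys`
  have hP3 : ∀ᶠ y in 𝓝 ys, ContDiffAt ℝ 3 P ((y 0 - c₀ (y 2)) ^ 2 + (y 1 - c₁ (y 2)) ^ 2, y 2) :=
    (hΨc.tendsto ys).eventually (hPc.eventually (by simp))
  -- `V = W` near `ys` (`W = P ∘ Ψ`), hence equal first and second derivatives near `ys`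
  have hVW : ∀ᶠ y in 𝓝 ys, V =ᶠ[𝓝 y] fun y' : EuclideanSpace ℝ (Fin 3) => P ((y' 0 - c₀ (y' 2)) ^ 2 + (y' 1 - c₁ (y' 2)) ^ 2, y' 2) :=
    hPeq.eventually_nhds.mono fun y h => h
  have hD1 : ∀ᶠ y in 𝓝 ys, fderiv ℝ V y = fderiv ℝ (fun y' : EuclideanSpace ℝ (Fin 3) => P ((y' 0 - c₀ (y' 2)) ^ 2 + (y' 1 - c₁ (y' 2)) ^ 2, y' 2)) y :=
    hVW.mono fun y h => h.fderiv_eq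
  have hD2 : ∀ᶠ y in 𝓝 ys, fderiv ℝ (fun y' => fderiv ℝ V y' (EuclideanSpace.single 2 1)) y =
      fderiv ℝ (fun y' => fderiv ℝ (fun y'' : EuclideanSpace ℝ (Fin 3) => P ((y'' 0 - c₀ (y'' 2)) ^ 2 + (y'' 1 - c₁ (y'' 2)) ^ 2, y'' 2)) y' (EuclideanSpace.single 2 1)) y :=
    hD1.eventually_nhds.mono fun y h => by
      have h' : (fun y' => fderiv ℝ V y' (EuclideanSpace.single 2 1)) =ᶠ[𝓝 y]
          fun y' => fderiv ℝ (fun y'' : EuclideanSpace ℝ (Fin 3) => P ((y'' 0 - c₀ (y'' 2)) ^ 2 + (y'' 1 - c₁ (y'' 2)) ^ 2, y'' 2)) y' (EuclideanSpace.single 2 1) :=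
        h.mono fun y' hy' => by
          show fderiv ℝ V y' (EuclideanSpace.single 2 1) = _
          rw [hy']
      exact h'.fderiv_eq
  have hOmem : ∀ᶠ y in 𝓝 ys, y ∈ O := hO.mem_nhds hys
  -- an open neighbourhood `B` of `ys` on which everything holds
  obtain ⟨B, hBsub, hBo, hysB⟩ := _root_.mem_nhds_iff.1 (hOmem.and (hP3.and (hD1.and hD2)))
  have hBO : ∀ y ∈ B, y ∈ O := fun y hy => (hBsub hy).1
  have hBP : ∀ y ∈ B, ContDiffAt ℝ 3 P ((y 0 - c₀ (y 2)) ^ 2 + (y 1 - c₁ (y 2)) ^ 2, y 2) := fun y hy => (hBsub hy).2.1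
  have hBD1 : ∀ y ∈ B, fderiv ℝ V y = fderiv ℝ (fun y' : EuclideanSpace ℝ (Fin 3) => P ((y' 0 - c₀ (y' 2)) ^ 2 + (y' 1 - c₁ (y' 2)) ^ 2, y' 2)) y :=
    fun y hy => (hBsub hy).2.2.1
  have hBD2 : ∀ y ∈ B, fderiv ℝ (fun y' => fderiv ℝ V y' (EuclideanSpace.single 2 1)) y =
      fderiv ℝ (fun y' => fderiv ℝ (fun y'' : EuclideanSpace ℝ (Fin 3) => P ((y'' 0 - c₀ (y'' 2)) ^ 2 + (y'' 1 - c₁ (y'' 2)) ^ 2, y'' 2)) y' (EuclideanSpace.single 2 1)) y :=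
    fun y hy => (hBsub hy).2.2.2
  -- regularity of the partials of `P` at `Ψ y`, `y ∈ B`
  have hPr2 : ∀ y ∈ B, ContDiffAt ℝ 2 (fun q => fderiv ℝ P q (1, 0)) ((y 0 - c₀ (y 2)) ^ 2 + (y 1 - c₁ (y 2)) ^ 2, y 2) := fun y hy =>
    ((hBP y hy).fderiv_right (m := 2) (by norm_num)).clm_apply contDiffAt_const
  have hPz2 : ∀ y ∈ B, ContDiffAt ℝ 2 (fun q => fderiv ℝ P q (0, 1)) ((y 0 - c₀ (y 2)) ^ 2 + (y 1 - c₁ (y 2)) ^ 2, y 2) := fun y hy =>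
    ((hBP y hy).fderiv_right (m := 2) (by norm_num)).clm_apply contDiffAt_const
  have hPrr1 : ∀ y ∈ B, ContDiffAt ℝ 1 (fun q => fderiv ℝ (fun q' => fderiv ℝ P q' (1, 0)) q (1, 0)) ((y 0 - c₀ (y 2)) ^ 2 + (y 1 - c₁ (y 2)) ^ 2, y 2) :=
    fun y hy => ((hPr2 y hy).fderiv_right (m := 1) (by norm_num)).clm_apply contDiffAt_const
  have hPzr1 : ∀ y ∈ B, ContDiffAt ℝ 1 (fun q => fderiv ℝ (fun q' => fderiv ℝ P q' (0, 1)) q (1, 0)) ((y 0 - c₀ (y 2)) ^ 2 + (y 1 - c₁ (y 2)) ^ 2, y 2) :=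
    fun y hy => ((hPz2 y hy).fderiv_right (m := 1) (by norm_num)).clm_apply contDiffAt_const
  have hPdn : ∀ y ∈ B, ∀ᶠ q in 𝓝 ((y 0 - c₀ (y 2)) ^ 2 + (y 1 - c₁ (y 2)) ^ 2, y 2), DifferentiableAt ℝ P q := fun y hy =>
    ((hBP y hy).eventually (by simp)).mono fun q hq => hq.differentiableAt h3ne
  -- constant vectors at the height `z₀ = (ys)₂`
  set z₀ : ℝ := ys 2 with hz₀
  set cc : EuclideanSpace ℝ (Fin 3) := WithLp.toLp 2 ![c₀ z₀, c₁ z₀, 0] with hcc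
  set a : EuclideanSpace ℝ (Fin 3) := WithLp.toLp 2 ![deriv c₀ z₀, deriv c₁ z₀, 0] with ha
  set w' : EuclideanSpace ℝ (Fin 3) := WithLp.toLp 2 ![-deriv (deriv c₁) z₀, deriv (deriv c₀) z₀, 0] with hw'
  have hcc0 : cc 0 = c₀ z₀ := rfl
  have hcc1 : cc 1 = c₁ z₀ := rfl
  have ha0 : a 0 = deriv c₀ z₀ := rfl
  have ha1 : a 1 = deriv c₁ z₀ := rfl
  have hw'0 : w' 0 = -deriv (deriv c₁) z₀ := rfl
  have hw'1 : w' 1 = deriv (deriv c₀) z₀ := rfl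
  -- on the plane, the generator about `cc` is the moving one
  have hLeq : ∀ (f : EuclideanSpace ℝ (Fin 3) → ℝ) (y : EuclideanSpace ℝ (Fin 3)), y 2 = z₀ →
      fderiv ℝ f y (rotGen (y - cc)) =
        (y 0 - c₀ (y 2)) * fderiv ℝ f y (EuclideanSpace.single 1 1) - (y 1 - c₁ (y 2)) * fderiv ℝ f y (EuclideanSpace.single 0 1) := by
    intro f y hyz
    rw [fderiv_rotGen_sub_eq, hcc0, hcc1, hyz]
  -- L-annihilation of `k · Q(Ψ)` at plane points
  have hLQ : ∀ (Q : ℝ × ℝ → ℝ) (k : ℝ) (y : EuclideanSpace ℝ (Fin 3)), y 2 = z₀ →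
      DifferentiableAt ℝ Q ((y 0 - c₀ (y 2)) ^ 2 + (y 1 - c₁ (y 2)) ^ 2, y 2) →
      fderiv ℝ (fun y' : EuclideanSpace ℝ (Fin 3) => k * Q ((y' 0 - c₀ (y' 2)) ^ 2 + (y' 1 - c₁ (y' 2)) ^ 2, y' 2)) y (rotGen (y - cc)) = 0 := by
    intro Q k y hyz hQ
    have hQd : DifferentiableAt ℝ (fun y' : EuclideanSpace ℝ (Fin 3) => Q ((y' 0 - c₀ (y' 2)) ^ 2 + (y' 1 - c₁ (y' 2)) ^ 2, y' 2)) y := hQ.comp y (hΨd y)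
    rw [hLeq _ y hyz, fderiv_const_mul hQd]
    simp only [smul_apply, smul_eq_mul]
    have h0 := rotDeriv_comp_sqDistMoving (Q := Q) (hc₀d (y 2)) (hc₁d (y 2)) hQ
    have : (y 0 - c₀ (y 2)) * (k * fderiv ℝ (fun y' : EuclideanSpace ℝ (Fin 3) => Q ((y' 0 - c₀ (y' 2)) ^ 2 + (y' 1 - c₁ (y' 2)) ^ 2, y' 2)) y (EuclideanSpace.single 1 1)) -
        (y 1 - c₁ (y 2)) * (k * fderiv ℝ (fun y' : EuclideanSpace ℝ (Fin 3) => Q ((y' 0 - c₀ (y' 2)) ^ 2 + (y' 1 - c₁ (y' 2)) ^ 2, y' 2)) y (EuclideanSpace.single 0 1)) =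
        k * ((y 0 - c₀ (y 2)) * fderiv ℝ (fun y' : EuclideanSpace ℝ (Fin 3) => Q ((y' 0 - c₀ (y' 2)) ^ 2 + (y' 1 - c₁ (y' 2)) ^ 2, y' 2)) y (EuclideanSpace.single 1 1) -
          (y 1 - c₁ (y 2)) * fderiv ℝ (fun y' : EuclideanSpace ℝ (Fin 3) => Q ((y' 0 - c₀ (y' 2)) ^ 2 + (y' 1 - c₁ (y' 2)) ^ 2, y' 2)) y (EuclideanSpace.single 0 1)) := by ring
    rw [this, h0, mul_zero]
  -- differentiability of `k · Q(Ψ)` at `y`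
  have hdQ : ∀ (Q : ℝ × ℝ → ℝ) (k : ℝ) (y : EuclideanSpace ℝ (Fin 3)), DifferentiableAt ℝ Q ((y 0 - c₀ (y 2)) ^ 2 + (y 1 - c₁ (y 2)) ^ 2, y 2) →
      DifferentiableAt ℝ (fun y' : EuclideanSpace ℝ (Fin 3) => k * Q ((y' 0 - c₀ (y' 2)) ^ 2 + (y' 1 - c₁ (y' 2)) ^ 2, y' 2)) y := fun Q k y hQ =>
    (hQ.comp y (hΨd y)).const_mul k
  -- THE IDENTITY (★) IN COEFFICIENT FORM on `B ∩ {y₂ = z₀}`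
  have hΦ : ∀ y ∈ B, y 2 = z₀ →
      (-8 * fderiv ℝ (fun q' => fderiv ℝ P q' (1, 0)) ((y 0 - c₀ (y 2)) ^ 2 + (y 1 - c₁ (y 2)) ^ 2, y 2) (1, 0)) *
          (((y 0 - cc 0) * (-a 1) + (y 1 - cc 1) * a 0) * ((y 0 - cc 0) * a 0 + (y 1 - cc 1) * a 1)) +
        (4 * fderiv ℝ (fun q' => fderiv ℝ P q' (0, 1)) ((y 0 - c₀ (y 2)) ^ 2 + (y 1 - c₁ (y 2)) ^ 2, y 2) (1, 0)) * ((y 0 - cc 0) * (-a 1) + (y 1 - cc 1) * a 0) +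
        (2 * fderiv ℝ P ((y 0 - c₀ (y 2)) ^ 2 + (y 1 - c₁ (y 2)) ^ 2, y 2) (1, 0)) * ((y 0 - cc 0) * w' 0 + (y 1 - cc 1) * w' 1) = 0 := by
    intro y hy hyz
    -- (★) from …AxisKinematics3 at `y`
    have star := rotGerm_vert2_moving hV hc₀2 hc₁2 hO hR (hBO y hy)
    rw [hS y (hBO y hy)] at star
    -- replace `V`-derivatives by `W`-derivatives
    rw [hBD2 y hy, hBD1 y hy] at star
    -- the second-order coefficients (…AxisKinematics9) and the first-order ones (…AxisKinematics8)
    have h9_0 := fderiv_horizontal_fderiv_vertical (P := P) (y := y) hc₀2 hc₁2 (hPdn y hy)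
      ((hPr2 y hy).differentiableAt (by norm_num)) ((hPz2 y hy).differentiableAt (by norm_num))
      (w := EuclideanSpace.single 0 1) (by simp)
    have h9_1 := fderiv_horizontal_fderiv_vertical (P := P) (y := y) hc₀2 hc₁2 (hPdn y hy)
      ((hPr2 y hy).differentiableAt (by norm_num)) ((hPz2 y hy).differentiableAt (by norm_num))
      (w := EuclideanSpace.single 1 1) (by simp)
    have hPd : DifferentiableAt ℝ P ((y 0 - c₀ (y 2)) ^ 2 + (y 1 - c₁ (y 2)) ^ 2, y 2) := (hBP y hy).differentiableAt h3ne
    have h8_0 := fderiv_radialMoving_horizontal (P := P) (hc₀d (y 2)) (hc₁d (y 2)) hPd (p := EuclideanSpace.single 0 1) (by simp)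
    have h8_1 := fderiv_radialMoving_horizontal (P := P) (hc₀d (y 2)) (hc₁d (y 2)) hPd (p := EuclideanSpace.single 1 1) (by simp)
    rw [h9_0, h9_1, h8_0, h8_1] at star
    have s00 : (EuclideanSpace.single (0 : Fin 3) (1 : ℝ) : EuclideanSpace ℝ (Fin 3)) 0 = 1 := by simp
    have s01 : (EuclideanSpace.single (0 : Fin 3) (1 : ℝ) : EuclideanSpace ℝ (Fin 3)) 1 = 0 := by simp
    have s10 : (EuclideanSpace.single (1 : Fin 3) (1 : ℝ) : EuclideanSpace ℝ (Fin 3)) 0 = 0 := by simp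
    have s11 : (EuclideanSpace.single (1 : Fin 3) (1 : ℝ) : EuclideanSpace ℝ (Fin 3)) 1 = 1 := by simp
    rw [s00, s01, s10, s11] at star
    rw [hcc0, hcc1, ha0, ha1, hw'0, hw'1]
    rw [hyz] at star ⊢
    linear_combination (-1 : ℝ) * star
  -- conclude on `B ∩ {y₂ = z₀}` via the per-plane angular-harmonics lemma (…AxisKinematics7) on `B`
  filter_upwards [hBo.mem_nhds hysB] with y hy hyz
  have h := angular_harmonics_plane (α := fun y' => -8 * fderiv ℝ (fun q' => fderiv ℝ P q' (1, 0)) ((y' 0 - c₀ (y' 2)) ^ 2 + (y' 1 - c₁ (y' 2)) ^ 2, y' 2) (1, 0))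
    (β := fun y' => 4 * fderiv ℝ (fun q' => fderiv ℝ P q' (0, 1)) ((y' 0 - c₀ (y' 2)) ^ 2 + (y' 1 - c₁ (y' 2)) ^ 2, y' 2) (1, 0))
    (γ := fun y' => 2 * fderiv ℝ P ((y' 0 - c₀ (y' 2)) ^ 2 + (y' 1 - c₁ (y' 2)) ^ 2, y' 2) (1, 0)) (c := cc) (a := a) (w' := w') hBo (z₀ := z₀)
    (fun y' hy' _ => hdQ (fun q => fderiv ℝ (fun q' => fderiv ℝ P q' (1, 0)) q (1, 0)) (-8) y'
      ((hPrr1 y' hy').differentiableAt (by norm_num)))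
    (fun y' hy' _ => hdQ (fun q => fderiv ℝ (fun q' => fderiv ℝ P q' (0, 1)) q (1, 0)) 4 y'
      ((hPzr1 y' hy').differentiableAt (by norm_num)))
    (fun y' hy' _ => hdQ (fun q => fderiv ℝ P q (1, 0)) 2 y' ((hPr2 y' hy').differentiableAt (by norm_num)))
    (fun y' hy' hyz' => hLQ (fun q => fderiv ℝ (fun q' => fderiv ℝ P q' (1, 0)) q (1, 0)) (-8) y' hyz'
      ((hPrr1 y' hy').differentiableAt (by norm_num)))
    (fun y' hy' hyz' => hLQ (fun q => fderiv ℝ (fun q' => fderiv ℝ P q' (0, 1)) q (1, 0)) 4 y' hyz'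
      ((hPzr1 y' hy').differentiableAt (by norm_num)))
    (fun y' hy' hyz' => hLQ (fun q => fderiv ℝ P q (1, 0)) 2 y' hyz' ((hPr2 y' hy').differentiableAt (by norm_num)))
    hΦ hy hyz
  rw [hcc0, hcc1, ha0, ha1] at h
  have h' : fderiv ℝ (fun q' => fderiv ℝ P q' (1, 0)) ((y 0 - c₀ (y 2)) ^ 2 + (y 1 - c₁ (y 2)) ^ 2, y 2) (1, 0) *
      (((y 0 - c₀ z₀) * (-deriv c₁ z₀) + (y 1 - c₁ z₀) * deriv c₀ z₀) *
        ((y 0 - c₀ z₀) * deriv c₀ z₀ + (y 1 - c₁ z₀) * deriv c₁ z₀)) = 0 := by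
    have : (-8 : ℝ) ≠ 0 := by norm_num
    have h2 := h
    rw [mul_assoc] at h2
    rcases mul_eq_zero.1 h2 with h8 | hrest
    · exact absurd h8 this
    · exact hrest
  exact h'

end Summit.NavierStokesRegularity.NavierStokesRegularity.Theorems.PoloidalWindowDoorLrcModEntireAxisKinematics10

end
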